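import Summits.Ventures.Crystal3D.Theorems.StickyWulffConstantGenericWallFloorRayTerraceGlue
import Summits.Ventures.Crystal3D.Theorems.StickyWulffConstantGenericWallFloorRayTerraceFar
import Summits.Ventures.Crystal3D.Theorems.StickyWulffConstantGenericWallFloorAtDirs
import Summits.Ventures.Crystal3D.Theorems.StickyWulffConstantGenericWallFloorAtDirsDown
import HarnessLib

/-!
# The terrace-steered steep family, part 7: the CAPSTONE — census-free charge `(√2/2)·(A u)₂` on the `Σ9` cap, both grains
# (crux `GenericWallFloor`, stmt-Ventures-19480, line `WallLedgerG`)

HONEST FRAMING. Venture `Summits/Ventures/Crystal3D` (cell `crystal3d-full`), helper `--supports` the crux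
`GenericWallFloor` (stmt-Ventures-19480) of `route-Ventures-StickyWulffConstant`, REGISTERED line `WallLedgerG`, open
stub `stub_twoSlabAdhesion`.  Rung credit only; F-C1 not moved; NOT the stub, NOT `c₀ = 1`: a ONE-SIDED floor
`(√2/2)·(A u)₂ ≈ 0.55–0.59` on the cap, modulo the named facts `ExactOnly`(C12-55) and `StarPairFar` exactly as in
19480-p2's `…AtDirs`.  Census-free, standard axioms.

All four family-side hypotheses of 19480-p2's W1-conditional one-sided ledgers are theorems for the terrace-steered steep
family on the `Σ9` cap of lane G's residual (parts 2–6), so the ledgers fire BY NAME: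
* **`genericWallFloorAtCharge_terrace_up`** — grain 1 walking up: base frame `A₁`, start slot `slotSite 8`, steering
  `z = A₁ ẑ` (`cubicCoords ẑ = (34,32,33)/√3269`), the far grain presented over `A₁` by a two-letter model word through
  the terrace (`κ₁ = ±(1,1,1)/√3`, `κ₀ ≠ ±(1,−1,−1)/√3`), and `‖A₁.symm e₃ − w₀‖ ≤ 1/4` (`w₀` cubic `(1,1,4)/(3√2)`):
  `GenericWallFloorAtCharge (√2·(A₁ u)₂/2) A₁ t₁ A₂ t₂` — every translation pair.
  Inputs: `hsteep` (`exists_terrace_steering`), `hup` (`(A₁u)₂ ≥ 5/6 − 1/4`, `start_slot_inner_terrace`), `hmiss`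
  (`image_ne_of_terrace_word`), `hdirs` (`hdirs_terrace_up`).
* **`genericWallFloorAtCharge_terrace_down`** — grain 2 walking down, mirror statement (`−e₃`, word over `A₂`).
WHAT THIS IS NOT: `c₀ = 1` on the cap needs the shell rows (`shellRow_G1..G7`, p660959) and their coverage glue, or the
two-family composition; not claimed here.  F-C1 not moved.
-/

noncomputable section

namespace Summit.Ventures.Crystal3D.Theorems

open Summit.Ventures.Crystal3D Finset Matrix
open Literature.MathematicalPhysics.StatisticalMechanics (fccStacking)
open scoped InnerProductSpace

/-- The true rise of the start slot near the cap centre: `(A u)·w ≥ 5/6 − ‖A.symm w − w₀‖`. -/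
theorem start_slot_inner_ge (A : EuclideanSpace ℝ (Fin 3) ≃ₗᵢ[ℝ] EuclideanSpace ℝ (Fin 3)) {w₀ : EuclideanSpace ℝ (Fin 3)}
    (hw₀ : cubicCoords w₀ = (3 * Real.sqrt 2)⁻¹ • (![(1 : ℝ), 1, 4] : Fin 3 → ℝ)) (w : EuclideanSpace ℝ (Fin 3)) :
    5 / 6 - ‖A.symm w - w₀‖ ≤ ⟪A (slotSite 8), w⟫_ℝ := by
  have h56 := start_slot_inner_terrace A hw₀
  have hsplit : ⟪A (slotSite 8), w⟫_ℝ = ⟪A (slotSite 8), A w₀⟫_ℝ + ⟪A (slotSite 8), w - A w₀⟫_ℝ := by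
    rw [← inner_add_right, add_sub_cancel]
  have hCS : |⟪A (slotSite 8), w - A w₀⟫_ℝ| ≤ ‖A (slotSite 8)‖ * ‖w - A w₀‖ := abs_real_inner_le_norm _ _
  have hn1 : ‖A (slotSite 8)‖ = 1 := by rw [LinearIsometryEquiv.norm_map]; exact norm_eq_one_of_mem_fccSlots (slotSite_mem 8)
  have hnorm : ‖w - A w₀‖ = ‖A.symm w - w₀‖ := by
    rw [← A.symm.norm_map (w - A w₀), map_sub, A.symm_apply_apply]
  rw [hn1, one_mul, hnorm] at hCS
  have := neg_le_of_abs_le hCS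
  linarith

/-- **Census-free one-sided floor on the `Σ9` cap, grain 1 walking UP** (see the module docstring). -/
theorem genericWallFloorAtCharge_terrace_up
    {s₀ : EuclideanSpace ℝ (Fin 3)} (hs₀ : s₀ ∈ fccSlots)
    (hcert : ExactOnly 0 (fccSlots.filter fun w => 0 < ⟪w, s₀⟫_ℝ)) (hSP : StarPairFar)
    (A₁ : EuclideanSpace ℝ (Fin 3) ≃ₗᵢ[ℝ] EuclideanSpace ℝ (Fin 3)) (t₁ : EuclideanSpace ℝ (Fin 3))
    (A₂ : EuclideanSpace ℝ (Fin 3) ≃ₗᵢ[ℝ] EuclideanSpace ℝ (Fin 3)) (t₂ : EuclideanSpace ℝ (Fin 3))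
    {zs w₀ : EuclideanSpace ℝ (Fin 3)} (hzs1 : ‖zs‖ = 1)
    (hzsc : cubicCoords zs = (Real.sqrt 3269)⁻¹ • (![(34 : ℝ), 32, 33] : Fin 3 → ℝ))
    (hw₀ : cubicCoords w₀ = (3 * Real.sqrt 2)⁻¹ • (![(1 : ℝ), 1, 4] : Fin 3 → ℝ))
    (hnear : ‖A₁.symm (EuclideanSpace.single (2 : Fin 3) (1 : ℝ)) - w₀‖ ≤ 1 / 4)
    (κ₀ κ₁ : EuclideanSpace ℝ (Fin 3))
    (hκl : ∀ μ ∈ [κ₀, κ₁], ‖μ‖ = 1 ∧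
      ∀ w ∈ fccSlots, ⟪w, μ⟫_ℝ = 0 ∨ ⟪w, μ⟫_ℝ = Real.sqrt (2 / 3) ∨ ⟪w, μ⟫_ℝ = -Real.sqrt (2 / 3))
    (hκc : List.IsChain (fun μ μ' => ⟪μ, μ'⟫_ℝ = 1 / 3 ∨ ⟪μ, μ'⟫_ℝ = -1 / 3) [κ₀, κ₁])
    (hκ₁ : cubicCoords κ₁ = (Real.sqrt 3)⁻¹ • (![(1 : ℝ), 1, 1] : Fin 3 → ℝ) ∨
      cubicCoords κ₁ = -((Real.sqrt 3)⁻¹ • (![(1 : ℝ), 1, 1] : Fin 3 → ℝ)))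
    (hκ₀ : cubicCoords κ₀ ≠ (Real.sqrt 3)⁻¹ • (![(1 : ℝ), -1, -1] : Fin 3 → ℝ) ∧
      cubicCoords κ₀ ≠ -((Real.sqrt 3)⁻¹ • (![(1 : ℝ), -1, -1] : Fin 3 → ℝ)))
    (hB : A₂ '' fccStacking 1 (Real.sqrt (2 / 3)) = (wordFrame A₁ [κ₀, κ₁]) '' fccStacking 1 (Real.sqrt (2 / 3))) :
    GenericWallFloorAtCharge (Real.sqrt 2 * (A₁ (slotSite 8)) 2 / 2) A₁ t₁ A₂ t₂ := by
  obtain ⟨zs', hzs1', hzsc', ht, hA⟩ := exists_terrace_steering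
  have hzz : zs = zs' := cubicCoords_injective (by rw [hzsc, hzsc'])
  subst hzz
  obtain ⟨hZ, hsteep⟩ := hA A₁
  have hz : ‖A₁ zs‖ = 1 := by rw [LinearIsometryEquiv.norm_map, hzs1]
  have he₃ : (A₁ (slotSite 8)) 2 = ⟪A₁ (slotSite 8), EuclideanSpace.single (2 : Fin 3) (1 : ℝ)⟫_ℝ := by
    rw [EuclideanSpace.inner_single_right]; simp
  have hup : (1 / 4 : ℝ) ≤ (A₁ (slotSite 8)) 2 := by
    rw [he₃]; have := start_slot_inner_ge A₁ hw₀ (EuclideanSpace.single (2 : Fin 3) (1 : ℝ)); linarith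
  exact genericWallFloorAtCharge_oneSided_dirs hs₀ hcert hSP A₁ t₁ A₂ t₂ hz (slotSite_mem 8) hsteep (by norm_num) hup
    (image_ne_of_terrace_word A₁ A₂ hZ ht κ₀ κ₁ hκl hκc hκ₁ hκ₀ hB)
    (hdirs_terrace_up A₁ hZ ht hw₀ (by linarith))

/-- **Census-free one-sided floor on the `Σ9` cap, grain 2 walking DOWN** (mirror statement: inward vertical `−e₃`, the far
grain `A₁` presented over `A₂` by the two-letter word through `A₂`'s terrace). -/
theorem genericWallFloorAtCharge_terrace_down
    {s₀ : EuclideanSpace ℝ (Fin 3)} (hs₀ : s₀ ∈ fccSlots)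
    (hcert : ExactOnly 0 (fccSlots.filter fun w => 0 < ⟪w, s₀⟫_ℝ)) (hSP : StarPairFar)
    (A₁ : EuclideanSpace ℝ (Fin 3) ≃ₗᵢ[ℝ] EuclideanSpace ℝ (Fin 3)) (t₁ : EuclideanSpace ℝ (Fin 3))
    (A₂ : EuclideanSpace ℝ (Fin 3) ≃ₗᵢ[ℝ] EuclideanSpace ℝ (Fin 3)) (t₂ : EuclideanSpace ℝ (Fin 3))
    {zs w₀ : EuclideanSpace ℝ (Fin 3)} (hzs1 : ‖zs‖ = 1)
    (hzsc : cubicCoords zs = (Real.sqrt 3269)⁻¹ • (![(34 : ℝ), 32, 33] : Fin 3 → ℝ))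
    (hw₀ : cubicCoords w₀ = (3 * Real.sqrt 2)⁻¹ • (![(1 : ℝ), 1, 4] : Fin 3 → ℝ))
    (hnear : ‖A₂.symm (-EuclideanSpace.single (2 : Fin 3) (1 : ℝ)) - w₀‖ ≤ 1 / 4)
    (κ₀ κ₁ : EuclideanSpace ℝ (Fin 3))
    (hκl : ∀ μ ∈ [κ₀, κ₁], ‖μ‖ = 1 ∧
      ∀ w ∈ fccSlots, ⟪w, μ⟫_ℝ = 0 ∨ ⟪w, μ⟫_ℝ = Real.sqrt (2 / 3) ∨ ⟪w, μ⟫_ℝ = -Real.sqrt (2 / 3))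
    (hκc : List.IsChain (fun μ μ' => ⟪μ, μ'⟫_ℝ = 1 / 3 ∨ ⟪μ, μ'⟫_ℝ = -1 / 3) [κ₀, κ₁])
    (hκ₁ : cubicCoords κ₁ = (Real.sqrt 3)⁻¹ • (![(1 : ℝ), 1, 1] : Fin 3 → ℝ) ∨
      cubicCoords κ₁ = -((Real.sqrt 3)⁻¹ • (![(1 : ℝ), 1, 1] : Fin 3 → ℝ)))
    (hκ₀ : cubicCoords κ₀ ≠ (Real.sqrt 3)⁻¹ • (![(1 : ℝ), -1, -1] : Fin 3 → ℝ) ∧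
      cubicCoords κ₀ ≠ -((Real.sqrt 3)⁻¹ • (![(1 : ℝ), -1, -1] : Fin 3 → ℝ)))
    (hB : A₁ '' fccStacking 1 (Real.sqrt (2 / 3)) = (wordFrame A₂ [κ₀, κ₁]) '' fccStacking 1 (Real.sqrt (2 / 3))) :
    GenericWallFloorAtCharge (Real.sqrt 2 * (-(A₂ (slotSite 8)) 2) / 2) A₁ t₁ A₂ t₂ := by
  obtain ⟨zs', hzs1', hzsc', ht, hA⟩ := exists_terrace_steering
  have hzz : zs = zs' := cubicCoords_injective (by rw [hzsc, hzsc'])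
  subst hzz
  obtain ⟨hZ, hsteep⟩ := hA A₂
  have hz : ‖A₂ zs‖ = 1 := by rw [LinearIsometryEquiv.norm_map, hzs1]
  have he₃ : -(A₂ (slotSite 8)) 2 = ⟪A₂ (slotSite 8), -EuclideanSpace.single (2 : Fin 3) (1 : ℝ)⟫_ℝ := by
    rw [inner_neg_right, EuclideanSpace.inner_single_right]; simp
  have hdown : (1 / 4 : ℝ) ≤ -(A₂ (slotSite 8)) 2 := by
    rw [he₃]; have := start_slot_inner_ge A₂ hw₀ (-EuclideanSpace.single (2 : Fin 3) (1 : ℝ)); linarith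
  exact genericWallFloorAtCharge_oneSidedDown_dirs hs₀ hcert hSP A₁ t₁ A₂ t₂ hz (slotSite_mem 8) hsteep (by norm_num) hdown
    (image_ne_of_terrace_word A₂ A₁ hZ ht κ₀ κ₁ hκl hκc hκ₁ hκ₀ hB)
    (hdirs_terrace_down A₂ hZ ht hw₀ (by linarith))

end Summit.Ventures.Crystal3D.Theorems

end
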